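import Summits.Ventures.Crystal3D.Theorems.StickyWulffConstantStackingLiminfOptimalCalibrationII
import HarnessLib

/-!
# The optimal calibration toward `StackingLiminf` (stmt-Ventures-19145): an elementary VALUE
# ESTIMATE `(3 − 2c/β_c)·M − K√M ≤ 2G(M)` (tangent-line version of cf-p2 R20 blueprint L5)

Route `StickyWulffConstant` of the venture `Summits/Ventures/Crystal3D` (cell `crystal3d-full`).
Blueprint L5 asks for `B_c M − K_c √M ≤ 2G(M)` with the OPTIMAL
`B_c = 1 + (2/3)(36 + 6√3c + c²)/β_c²` (`β_c = 2√3 + c`), via a sum-versus-integral comparison.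
This file proves the slightly weaker but fully elementary bound with
`B = 3 − 2c/β_c` (for `c = 1`: `2.5520` vs the optimal `2.5854`; for `c = √2`: `2.4202` vs `2.4762`)
by the TANGENT-LINE inequality `√(m/M) ≤ (1 + m/M)/2`: `φ(m) ≤ a m − b + √3/(2m)` with
`a = β_c/(2M)`, `b = √3 − c/2`, then `Σ_{m ≤ M} (a m − b)₊ ≤ (a(M+1) − b)²/(2a) = c²M/β_c + c + β_c/(4M)`
(discrete convexity, telescoping) and `Σ_{m ≤ M} 1/m ≤ 2√M` (telescoping `1/m ≤ 2(√m − √(m−1))`).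
Resulting rung constants (AM–GM `27 ω² B/4`): `c = 1` (layerProfile): `≈ ∛339–∛343 ≈ 6.97–7.00`;
`c = √2` (layerProfileSharp): `≈ ∛370–∛389 ≈ 7.18–7.30` — versus the landed `∛320 = 6.84` and the
ladder's exact ceiling `7.0324 / 7.3544` (cf-p2 R20), which needs the integral form of L5.
WHAT THIS IS NOT: the optimal constant; not the rung itself (assembly = separate file); F-C1 not moved.
-/

noncomputable section

namespace Summit.Ventures.Crystal3D.Theorems.OptimalCalibration

open Finset

/-- Secant bound for the square root below `12`: `√(12 − ε) ≥ 2√3 − ε/(2√3)·… `, in the form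
`s(m) ≥ 2√3 − √3/(2m)` for `m ≥ 1`. -/
theorem s_ge_sub (m : ℕ) (hm : 1 ≤ m) : 2 * Real.sqrt 3 - Real.sqrt 3 / (2 * m) ≤ s m := by
  have hm' : (1 : ℝ) ≤ m := by exact_mod_cast hm
  have hmpos : (0 : ℝ) < m := by linarith
  have h3 : Real.sqrt 3 ^ 2 = 3 := Real.sq_sqrt (by norm_num)
  have hs3 : 0 < Real.sqrt 3 := Real.sqrt_pos.2 (by norm_num)
  unfold s
  have hx0 : 0 ≤ 2 * Real.sqrt 3 - Real.sqrt 3 / (2 * m) := by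
    have : Real.sqrt 3 / (2 * m) ≤ Real.sqrt 3 / 1 :=
      div_le_div_of_nonneg_left hs3.le one_pos (by linarith)
    linarith
  have e : (2 * Real.sqrt 3 - Real.sqrt 3 / (2 * m)) ^ 2 = 12 - 2 * (3 / m) + 3 / (4 * m ^ 2) := by
    linear_combination (4 - 2 / (m : ℝ) + 1 / (4 * (m : ℝ) ^ 2)) * h3
  have hle : (2 * Real.sqrt 3 - Real.sqrt 3 / (2 * m)) ^ 2 ≤ 12 - 3 / m := by
    rw [e]
    have : 3 / (4 * (m : ℝ) ^ 2) ≤ 3 / m :=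
      div_le_div_of_nonneg_left (by norm_num) hmpos (by nlinarith)
    linarith
  calc 2 * Real.sqrt 3 - Real.sqrt 3 / (2 * m)
      = Real.sqrt ((2 * Real.sqrt 3 - Real.sqrt 3 / (2 * m)) ^ 2) := (Real.sqrt_sq hx0).symm
    _ ≤ Real.sqrt (12 - 3 / m) := Real.sqrt_le_sqrt hle

/-- `ω_M ≤ β_c = 2√3 + c` (as `s(M) ≤ 2√3`, `δ ≥ 0`). -/
theorem omega_le (c : ℝ) {δ : ℝ} (hδ : 0 ≤ δ) (M : ℕ) : omega c δ M ≤ 2 * Real.sqrt 3 + c := by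
  unfold omega s
  have h1 : Real.sqrt (12 - 3 / (M : ℝ)) ≤ Real.sqrt 12 := Real.sqrt_le_sqrt (by
    have : 0 ≤ 3 / (M : ℝ) := by positivity
    linarith)
  have h12 : Real.sqrt 12 = 2 * Real.sqrt 3 := by
    rw [show (12 : ℝ) = 2 ^ 2 * 3 by norm_num, Real.sqrt_mul (by norm_num), Real.sqrt_sq (by norm_num)]
  have h2 : 0 ≤ δ / Real.sqrt M := div_nonneg hδ (Real.sqrt_nonneg _)
  rw [h12] at h1
  linarith

/-- **Tangent-line bound for `φ`.** For `1 ≤ m`: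
`φ(m) ≤ (β_c/(2M)) m − (√3 − c/2) + √3/(2m)`. -/
theorem phi_le_tangent {c δ : ℝ} (hc : 0 < c) (hδ : 0 ≤ δ) (hδc : δ ≤ c) {M : ℕ} (hM : 31 ≤ M)
    {m : ℕ} (hm : 1 ≤ m) :
    phi c δ M m ≤ (2 * Real.sqrt 3 + c) / (2 * M) * m - (Real.sqrt 3 - c / 2) +
      Real.sqrt 3 / (2 * m) := by
  have hM' : (31 : ℝ) ≤ M := by exact_mod_cast hM
  have hMpos : (0 : ℝ) < M := by linarith
  have hm' : (1 : ℝ) ≤ m := by exact_mod_cast hm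
  have hsM : 0 < Real.sqrt M := Real.sqrt_pos.2 hMpos
  have hsm : 0 ≤ Real.sqrt m := Real.sqrt_nonneg _
  have hω0 : 0 ≤ omega c δ M := by linarith [three_le_omega hδ hδc hM]
  have hωβ := omega_le c hδ M
  -- `√m/√M ≤ (1 + m/M)/2`
  have htan : Real.sqrt m / Real.sqrt M ≤ (1 + (m : ℝ) / M) / 2 := by
    rw [div_le_iff₀ hsM]
    have hMM : Real.sqrt M * Real.sqrt M = M := Real.mul_self_sqrt hMpos.le
    have hmm : Real.sqrt m * Real.sqrt m = m := Real.mul_self_sqrt (by linarith)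
    have key : 2 * Real.sqrt m * Real.sqrt M ≤ M + m := by
      nlinarith [sq_nonneg (Real.sqrt M - Real.sqrt m)]
    rw [show (1 + (m : ℝ) / M) / 2 * Real.sqrt M = (M + m) / (2 * M) * Real.sqrt M by
      field_simp]
    rw [show Real.sqrt m = (2 * Real.sqrt m * Real.sqrt M) / (2 * M) * Real.sqrt M by
      field_simp; nlinarith [hMM]]
    exact mul_le_mul_of_nonneg_right (div_le_div_of_nonneg_right key (by linarith)) hsM.le
  have h1 : omega c δ M * Real.sqrt m / Real.sqrt M ≤ (2 * Real.sqrt 3 + c) * ((1 + (m : ℝ) / M) / 2) := by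
    rw [mul_div_assoc]
    exact mul_le_mul hωβ htan (div_nonneg hsm hsM.le) (by linarith)
  have h2 := s_ge_sub m hm
  unfold phi
  have e : (2 * Real.sqrt 3 + c) * ((1 + (m : ℝ) / M) / 2) =
      (2 * Real.sqrt 3 + c) / (2 * M) * m + (Real.sqrt 3 + c / 2) := by
    field_simp; ring
  linarith [h1, h2, e]

/-- `x + x²/(2a) ≤ (x + a)²/(2a)` for `a > 0` (the difference is `a/2`). -/
theorem add_sq_div_le {a : ℝ} (ha : 0 < a) (x : ℝ) : x + x ^ 2 / (2 * a) ≤ (x + a) ^ 2 / (2 * a) := by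
  rw [← sub_nonneg]
  have : (x + a) ^ 2 / (2 * a) - (x + x ^ 2 / (2 * a)) = a / 2 := by
    field_simp; ring
  rw [this]; positivity

/-- Discrete convexity: `Σ_{m=1}^{n} (a m − b)₊ ≤ ((a(n+1) − b)₊)²/(2a)` for `a > 0`. -/
theorem sum_posPart_affine_le {a b : ℝ} (ha : 0 < a) (n : ℕ) :
    ∑ m ∈ range n, max (a * ((m + 1 : ℕ) : ℝ) - b) 0 ≤
      (max (a * ((n + 1 : ℕ) : ℝ) - b) 0) ^ 2 / (2 * a) := by
  induction n with
  | zero => simp only [range_zero, sum_empty]; positivity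
  | succ n ih =>
    rw [sum_range_succ]
    have hcast : (a * ((n + 1 + 1 : ℕ) : ℝ) - b) = (a * ((n + 1 : ℕ) : ℝ) - b) + a := by
      push_cast; ring
    have hk : max (a * ((n + 1 : ℕ) : ℝ) - b) 0 + (max (a * ((n + 1 : ℕ) : ℝ) - b) 0) ^ 2 / (2 * a) ≤
        (max (a * ((n + 1 + 1 : ℕ) : ℝ) - b) 0) ^ 2 / (2 * a) := by
      rcases le_or_gt (a * ((n + 1 : ℕ) : ℝ) - b) 0 with h | h
      · rw [max_eq_right h]
        have : (0 : ℝ) + 0 ^ 2 / (2 * a) = 0 := by simp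
        rw [this]; positivity
      · rw [max_eq_left h.le, hcast, max_eq_left (by linarith)]
        exact add_sq_div_le ha _
    linarith [ih, hk]

/-- Telescoping harmonic bound: `Σ_{m=1}^{n} 1/m ≤ 2√n`. -/
theorem sum_inv_le_two_sqrt (n : ℕ) :
    ∑ m ∈ range n, (1 : ℝ) / ((m + 1 : ℕ) : ℝ) ≤ 2 * Real.sqrt n := by
  have hstep : ∀ m : ℕ, (1 : ℝ) / ((m + 1 : ℕ) : ℝ) ≤
      2 * (Real.sqrt ((m + 1 : ℕ) : ℝ) - Real.sqrt (m : ℝ)) := by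
    intro m
    have hm0 : (0 : ℝ) ≤ m := Nat.cast_nonneg m
    have hm1 : (0 : ℝ) < ((m + 1 : ℕ) : ℝ) := by positivity
    have ha := Real.sqrt_nonneg (m : ℝ)
    have hb : 0 < Real.sqrt ((m + 1 : ℕ) : ℝ) := Real.sqrt_pos.2 hm1
    have haa : Real.sqrt (m : ℝ) * Real.sqrt (m : ℝ) = m := Real.mul_self_sqrt hm0
    have hbb : Real.sqrt ((m + 1 : ℕ) : ℝ) * Real.sqrt ((m + 1 : ℕ) : ℝ) = ((m + 1 : ℕ) : ℝ) :=
      Real.mul_self_sqrt hm1.le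
    have hcast : (((m + 1 : ℕ) : ℝ)) = (m : ℝ) + 1 := by push_cast; ring
    -- `(√(m+1) + √m)(√(m+1) − √m) = 1` and `√(m+1) + √m ≤ 2(m+1)`… i.e. `1/(m+1) ≤ 2(√(m+1) − √m)`
    rw [div_le_iff₀ hm1]
    have hab : Real.sqrt (m : ℝ) ≤ Real.sqrt ((m + 1 : ℕ) : ℝ) := Real.sqrt_le_sqrt (by rw [hcast]; linarith)
    nlinarith [hbb, haa, hcast, sq_nonneg (Real.sqrt ((m + 1 : ℕ) : ℝ) - Real.sqrt (m : ℝ))]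
  calc ∑ m ∈ range n, (1 : ℝ) / ((m + 1 : ℕ) : ℝ)
      ≤ ∑ m ∈ range n, 2 * (Real.sqrt ((m + 1 : ℕ) : ℝ) - Real.sqrt (m : ℝ)) :=
        sum_le_sum fun m _ => hstep m
    _ = 2 * (Real.sqrt (n : ℝ) - Real.sqrt ((0 : ℕ) : ℝ)) := by
        rw [← mul_sum, Finset.sum_range_sub (fun m => Real.sqrt (m : ℝ)) n]
    _ = 2 * Real.sqrt n := by simp

/-- **The sum of the positive parts of `φ`.** For `M ≥ 31`:
`Σ_{m=1}^{M} φ₊(m) ≤ c²M/β_c + √3·√M + c + β_c/4`. -/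
theorem sum_phiPos_le {c δ : ℝ} (hc : 0 < c) (hδ : 0 ≤ δ) (hδc : δ ≤ c) {M : ℕ} (hM : 31 ≤ M) :
    ∑ m ∈ range M, max (phi c δ M (m + 1)) 0 ≤
      c ^ 2 * M / (2 * Real.sqrt 3 + c) + Real.sqrt 3 * Real.sqrt M + c + (2 * Real.sqrt 3 + c) / 4 := by
  have hM' : (31 : ℝ) ≤ M := by exact_mod_cast hM
  have hMpos : (0 : ℝ) < M := by linarith
  have hs3 : 0 < Real.sqrt 3 := Real.sqrt_pos.2 (by norm_num)
  set β := 2 * Real.sqrt 3 + c with hβ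
  have hβpos : 0 < β := by rw [hβ]; positivity
  set a := β / (2 * M) with ha
  have hapos : 0 < a := by rw [ha]; positivity
  set b := Real.sqrt 3 - c / 2 with hb
  -- termwise: `φ₊(m+1) ≤ (a(m+1) − b)₊ + √3/(2(m+1))`
  have hterm : ∀ m ∈ range M, max (phi c δ M (m + 1)) 0 ≤
      max (a * ((m + 1 : ℕ) : ℝ) - b) 0 + Real.sqrt 3 / 2 * (1 / ((m + 1 : ℕ) : ℝ)) := by
    intro m _
    have h := phi_le_tangent hc hδ hδc hM (m := m + 1) (by omega)
    have hpos : 0 ≤ Real.sqrt 3 / 2 * (1 / ((m + 1 : ℕ) : ℝ)) := by positivity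
    have e : Real.sqrt 3 / (2 * ((m + 1 : ℕ) : ℝ)) = Real.sqrt 3 / 2 * (1 / ((m + 1 : ℕ) : ℝ)) := by
      field_simp
    rw [e, ← ha, ← hb] at h
    refine max_le ?_ (by linarith [le_max_right (a * ((m + 1 : ℕ) : ℝ) - b) 0])
    linarith [le_max_left (a * ((m + 1 : ℕ) : ℝ) - b) 0]
  have hsum := sum_le_sum hterm
  rw [sum_add_distrib, ← mul_sum] at hsum
  have h1 := sum_posPart_affine_le (b := b) hapos M
  have h2 := sum_inv_le_two_sqrt M
  -- evaluate the square: `a(M+1) − b = c + β/(2M) > 0`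
  have hval : a * ((M + 1 : ℕ) : ℝ) - b = c + β / (2 * M) := by
    rw [ha, hb, hβ]; push_cast; field_simp; ring
  have hvpos : 0 < c + β / (2 * M) := by positivity
  rw [hval, max_eq_left hvpos.le] at h1
  have hsq : (c + β / (2 * M)) ^ 2 / (2 * a) = c ^ 2 * M / β + c + β / (4 * M) := by
    rw [ha]; field_simp; ring
  rw [hsq] at h1
  have h3 : β / (4 * M) ≤ β / 4 := div_le_div_of_nonneg_left hβpos.le (by norm_num) (by linarith)
  have h4 : Real.sqrt 3 / 2 * (2 * Real.sqrt M) = Real.sqrt 3 * Real.sqrt M := by ring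
  nlinarith [hsum, h1, h2, h3, h4, hs3]

/-- **Value estimate (tangent-line form of blueprint L5).** For `0 < c ≤ 2`, `0 ≤ δ ≤ c`, `M ≥ 31`:
`(3 − 2c/β_c)·M − (2√3/c + c)·√M − (2 + β_c/(2c)) ≤ 2·G(M)`, `β_c = 2√3 + c`. -/
theorem two_mul_G_top_ge {c δ : ℝ} (hc : 0 < c) (hδ : 0 ≤ δ) (hδc : δ ≤ c)
    {M : ℕ} (hM : 31 ≤ M) :
    (3 - 2 * c / (2 * Real.sqrt 3 + c)) * (M : ℝ) - (2 * Real.sqrt 3 / c + c) * Real.sqrt M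
      - (2 + (2 * Real.sqrt 3 + c) / (2 * c)) ≤ 2 * G c δ M M := by
  have hS := sum_phiPos_le hc hδ hδc hM
  rw [two_mul_G_top hc hM]
  have hs3 : 0 < Real.sqrt 3 := Real.sqrt_pos.2 (by norm_num)
  have hβpos : 0 < 2 * Real.sqrt 3 + c := by positivity
  have hsM : 0 ≤ Real.sqrt M := Real.sqrt_nonneg _
  -- `(2/c)·S ≤ 2cM/β + (2√3/c)√M + 2 + β/(2c)`
  have h := mul_le_mul_of_nonneg_left hS (by positivity : (0 : ℝ) ≤ 2 / c)
  have e : 2 / c * (c ^ 2 * M / (2 * Real.sqrt 3 + c) + Real.sqrt 3 * Real.sqrt M + c +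
      (2 * Real.sqrt 3 + c) / 4) =
      2 * c / (2 * Real.sqrt 3 + c) * M + 2 * Real.sqrt 3 / c * Real.sqrt M + 2 +
        (2 * Real.sqrt 3 + c) / (2 * c) := by
    field_simp; ring
  rw [e] at h
  nlinarith [h, hδ]

end Summit.Ventures.Crystal3D.Theorems.OptimalCalibration

end
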